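import Summits.BirchSwinnertonDyer.BirchSwinnertonDyer.Theorems.EisensteinPrimesMultOrderOneCoeffCertificate
import Summits.BirchSwinnertonDyer.BirchSwinnertonDyer.Theorems.EisensteinPrimesMazurMCOnCellBOfNamedFactsV7
import HarnessLib

/-!
# Crux 3 `MazurMCOnCellB` (stmt-BirchSwinnertonDyer-19033), line `twistback` v7 (sha256 0ee3d465…, REGISTERED 20:30:46Z) —
# ROAD (b) AT ONE MODEL: the ∃-PARTNER clause at a non-split X2b pair from ONE admissible `K` and ONE coefficient reading on
# ONE minimal model of the twist (PUBLISHED inputs only), and its fold «6″ ⇐ 6‴ + road (b)» with the cone UNCHANGED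

Width seat `bsd-line-x2-p1-w3` g13 (2026-08-28; `--supports` stmt-BirchSwinnertonDyer-19033). THEOREMS ONLY: no `def`, no
named fact introduced, no `sorry`; every step is a by-name application of a landed tree theorem (x2-p1-w3 g11 p660855 /
p661229 / p661814, LEAD x2-p1 g13 p665922, x2-p1-w3 g12 p664170, b2b's `X2.RankOneNonsplitCertificate`).

WHY. The registered open stub 6″ `stub_upperPartnerOffSubrowNoUnitEnd` asks the ∃-PARTNER at every X2b pair off the closed
sub-row («`p = 3`, `3` non-split, balance-1 datum») and off the unit ends (road (e), x2-p1-w6 g2). LEAD g13's v7 text records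
the per-pair closers as «ANY of: a unit end, a road-(b) certificate, a road-(c) datum»; v7 folded road (e) only. Road (b)
(LEAD verdicts g11–g13 §2 (ii): non-split pairs — 14/127 A10 cells with `c(E) ≠ 1`, and every non-split pair at `p ≠ 3`) is,
per pair, ONE admissible `K` and ONE `p`-adic lower bound on ONE modular-symbol sum: «`∃ k, p^{-(k+1)} < ‖[T¹](ϖ·L_p(Wd))‖`»
for THE non-split Mazur–Tate–Teitelbaum function of the partner (x2-p1-w3 g11 p661814). Its landed doors
(`…MultOrderOneCoeffCertificate.upperPartner_at_of_coeffOne_partner_of_padicGZ`,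
`…OrderOnePartnerPAdicGZ.upperPartner_at_of_orderOne_partner_of_padicGZ`) ask the reading on EVERY globally minimal model of
`E^{(d_K)}`; a certificate is computed on ONE model. This file closes that gap and folds the datum:

* §1 `upperPartner_at_of_coeffOne_partnerAt_of_padicGZ` — the ∃-PARTNER clause of 6′/6″ AT a NON-split X2b pair `(W, p)`,
  any odd `p`, from ONE admissible `K`, ONE globally minimal model `Wd` of `E^{(d_K)}` and the one-coefficient reading ON `Wd`
  ONLY. Inside: `Wd` is X2 (`X2.classX2_twist`), non-split at `p`, `GVPar` (parity flip), of odd analytic rank (`r_an(E) = 0`,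
  Heegner sign) ⟹ `[T⁰] = 0`, so the reading IS `ord_{T=0} L = 1` (`orderOne_of_coeffOneCertificate`) ⟹ `r_an(Wd) = 1`
  (Perrin-Riou + Disegni's `p`-adic Gross–Zagier at the non-split prime + Hoffstein–Luo + Gross–Zagier,
  `…MultOrderOnePAdicGZ.analyticRank_eq_one_of_orderOne_of_padicGZ`) ⟹ Mazur's MC at `(Wd, p)` is Greenberg–Vatsal's
  (`X2.mazurMainConjectureAt_of_gvPar`) ⟹ `BSDp Wd p` (`X2.bsdp_of_cellC_of_not_split_of_mazurMainConjectureAt_of_orderOne`: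
  Stein–Wuthrich Thm. 6.1 + Disegni Thm. 4(1)) ⟹ `BSDp` at EVERY globally minimal model of the twist by Cassels transport
  (`X2.bsdp_of_isIsogenous_of_bsdp`, as in p662647) ⟹ the upper half everywhere. Named facts BY NAME: `PublishedInputs`
  (stmt-…-19037), Disegni 2020 Thm. 4(1), Disegni 2020 Thm. 2.4 — ALL PUBLISHED; no Keller–Yin, no height / Schneider, no
  analytic-rank hypothesis on the partner.
* §2 `upperPartnerOffSubrowNoUnitEnd_of_noCoeffOnePartner_of_namedFacts` — the REGISTERED v7 stub 6″ (statement VERBATIM,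
  conclusion) FROM «6‴» = 6″ under ONE more negated hypothesis, the road-(b) datum of §1 VERBATIM («`p` non-split ∧
  ∃ admissible `K` ∧ ∃ minimal model `Wd` of the twist carrying the reading»), + `PublishedInputs` + Disegni Thm. 4(1) +
  Disegni Thm. 2.4:
  excluded middle on the datum. NO new named fact: the three inputs are already conjuncts of the v7 cone ((2a), (2i′), item
  -19037).
* §3 `mazurMCOnCellB_of_namedFacts_of_noUnitEnd_noCoeffOnePartner` — CRUX 3 BY NAME from `PublishedInputs` + the EIGHT PUBLISHED
  named facts of the v7 cone + Keller–Yin Thm. D (PRE) + 6‴, via §2 and LEAD g13's v7-cone theorem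
  `…OfNamedFactsV7.mazurMCOnCellB_of_namedFacts_of_upperPartnerOffSubrowNoUnitEnd` (p665922). So a reshape 6″ ↦ 6‴ (the
  road-(b) fold, sub-populations (ii)/(iii) non-split, any odd `p`) would be a token-level edit with its by-name closure already
  in the tree and the cone UNCHANGED {item -19037, 8 PUB, KY Thm. D, 6‴} — SAID for the next LEAD, not filed (W-79).

HONEST FRAMING: conditional theorems; named facts enter exactly as labelled (PUBLISHED; Keller–Yin Thm. D, §3 only, is an
UNREFEREED PREPRINT, flag `KYD-gap`); the road-(b) reading is a per-pair `p`-adic COMPUTATION (kit; lam-a's CA-g9-1 readings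
9/14 are numerical evidence, not kernel certificates) and the existence of such a `K` for every non-split X2b pair is OPEN
(«`p`-adic Bump–Friedberg–Hoffstein»: no horizontal non-vanishing theorem for `[T¹]L_p` in the quadratic-twist family is in
print — LEAD g13 verdict §2 (ii)); no registered stub is closed; no summit statement, no Mazur MC, no BSD is proved for any
curve; 0 cells / labels / stubs / tiers move.

References: [Disegni2020] §2.2 Thm. 2.4, §3.2 Thm. 4; [SteinWuthrich2013] §4.2, Thm. 6.1; [GreenbergVatsal2000] Thm. (1.3);
[PerrinRiou1987] §1.4; [MazurTateTeitelbaum1986] §I.10, §I.14; [Wuthrich2014] Thm. 16, Prop. 21; [MilneADT2006] I Thm. 7.3;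
[KellerYin2024] Thm. D (PRE); [HoffsteinLuo1997] Theorem; [GrossZagier1986] Thm. I.6.3.
-/

set_option autoImplicit false

-- `Summit.BirchSwinnertonDyer.BirchSwinnertonDyer.…`: the summit and its single sub-problem share a name.
set_option linter.dupNamespace false

noncomputable section

open scoped Classical MatrixGroups ModularForm

open CongruenceSubgroup WeierstrassCurve NumberField IsDedekindDomain Field
  Literature.NumberTheory.EllipticCurves
  Literature.NumberTheory.GaloisRepresentations
  Literature.NumberTheory.GaloisCohomology
  Literature.NumberTheory.EllipticCurves.ModularForms
  Literature.NumberTheory.QuadraticFields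
  Literature.NumberTheory.EllipticCurves.Rank1Residual
  Literature.NumberTheory.EllipticCurves.Rank1Residual.Typed
  Literature.NumberTheory.EllipticCurves.Wuthrich2014
  Literature.NumberTheory.EllipticCurves.SteinWuthrich2013
  Literature.NumberTheory.EllipticCurves.GreenbergVatsal2000
  Literature.NumberTheory.EllipticCurves.Disegni2020
  Literature.NumberTheory.EllipticCurves.KellerYin2024
  Summit.BirchSwinnertonDyer.Rank1Residual
  Summit.BirchSwinnertonDyer.Rank1Residual.X2
  Summit.BirchSwinnertonDyer.BirchSwinnertonDyer.Theses
  Summit.BirchSwinnertonDyer.BirchSwinnertonDyer.Theorems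
  Summit.BirchSwinnertonDyer.BirchSwinnertonDyer.Theorems.EisensteinPrimesMazurMCOnCellBTwistbackLowerHalf
  Summit.BirchSwinnertonDyer.BirchSwinnertonDyer.Theorems.EisensteinPrimesMazurMCOnCellBTwistbackLowerHalfByName
  Summit.BirchSwinnertonDyer.BirchSwinnertonDyer.Theorems.EisensteinPrimesMazurMCOnCellBTwistbackOnePartnerCertificates

namespace Summit.BirchSwinnertonDyer.BirchSwinnertonDyer.Theorems.EisensteinPrimesMazurMCOnCellBTwistbackCoeffOnePartnerAt

/-! ## §1. Road (b) AT ONE MODEL: the ∃-PARTNER clause from one admissible `K` and one coefficient reading on one model -/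

/-- **Stub 6′/6″'s ∃-PARTNER clause AT a NON-split X2b pair from ONE admissible `K` and the one-coefficient certificate on
ONE globally minimal model of the twist — PUBLISHED inputs only.** Data: `X2.CellB W p` with `p` non-split; `K` imaginary
quadratic, Heegner for `N_W` and for `p`, `d_K` odd `< −4`; ONE globally minimal model `Wd` of `E^{(d_K)}`; for every newform
`f` of `Wd`, `ϖ` with `ϖ·Ω(Wd) = Ω⁺_f` and every non-split Mazur–Tate–Teitelbaum function `L` of `(f, p)`, a `k` with
`p^{-(k+1)} < ‖[T¹](ϖ·L)‖` (`hC1`). Conclusion: the partner clause at `(W, p)` with witness `K` — `r_an(E^{(d_K)}) = 1` and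
the upper half `MissingUpperBoundAt` at EVERY globally minimal model of the twist. Proof: on `Wd` as in x2-p1-w3 g11's
p661814/p661229 (odd analytic rank ⟹ `ord_{T=0} L = 1` ⟹ `r_an(Wd) = 1` by Perrin-Riou + Disegni 2.4; MC by Greenberg–Vatsal on
the `GVPar` twist; `BSDp Wd p` by Stein–Wuthrich 6.1 + Disegni 4(1)); then `BSDp` is carried to every other minimal model by
Cassels (`X2.bsdp_of_isIsogenous_of_bsdp`, isomorphic ⟹ isogenous) and weakened to the upper half. Versus p661814 §3: the
reading is asked on ONE model, not on all. CONDITIONAL on the named facts (all PUBLISHED) and on the per-pair reading; the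
existence of such `K` class-wide is OPEN and not claimed. [cite: Disegni2020, §2.2 Thm. 2.4 and §3.2 Thm. 4]
[cite: SteinWuthrich2013, Thm. 6.1 (p. 20), §4.2] [cite: GreenbergVatsal2000, Thm. (1.3) with pp. 14–15]
[cite: PerrinRiou1987, §1.4 Cor. 1.8] [cite: MilneADT2006, Ch. I Thm. 7.3 (Cassels)] [cite: MazurTateTeitelbaum1986, §I.14] -/
theorem upperPartner_at_of_coeffOne_partnerAt_of_padicGZ (hP : EisensteinPrimes.PublishedInputs)
    (hDis : padicBSD_rankOne_nonsplitMult) (hDGZ : padicGrossZagier_nonsplitMult)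
    (W : WeierstrassCurve ℚ) [W.IsElliptic] [W.IsGloballyMinimal] (p : ℕ) [Fact p.Prime]
    (hc : X2.CellB W p) (hns : ¬ W.HasSplitMultiplicativeReductionAtPrime p)
    (K : Type) [Field K] [NumberField K] (hK : IsImaginaryQuadratic K)
    (hHN : SatisfiesHeegnerHypothesis (W.conductorNorm ℤ) K) (hHp : SatisfiesHeegnerHypothesis p K)
    (hodd : Odd (NumberField.discr K)) (hlt : NumberField.discr K < -4)
    (Wd : WeierstrassCurve ℚ) [Wd.IsElliptic] [Wd.IsGloballyMinimal]
    (hWd : ∃ C : VariableChange ℚ, C • Wd = W.quadraticTwist (NumberField.discr K : ℚ))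
    (hC1 : ∀ {M : ℕ} [NeZero M] (f : CuspForm (Gamma0 M) 2), IsNewformOf Wd f →
      ∀ (ϖ : ℚ), (ϖ : ℝ) * Wd.realPeriodRat = plusPeriod f →
      ∀ L : PowerSeries ℚ_[p], IsMultPAdicLFunctionOf f p (-1) L →
        ∃ k : ℕ, (p : ℝ) ^ (-((k : ℤ) + 1)) < ‖PowerSeries.coeff 1 (PowerSeries.C ((ϖ : ℚ) : ℚ_[p]) * L)‖) :
    ∃ (K : Type) (_ : Field K) (_ : NumberField K), IsImaginaryQuadratic K ∧
      SatisfiesHeegnerHypothesis (W.conductorNorm ℤ) K ∧ SatisfiesHeegnerHypothesis p K ∧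
      Odd (NumberField.discr K) ∧ NumberField.discr K < -4 ∧
      (W.quadraticTwist (NumberField.discr K : ℚ)).analyticRank = 1 ∧
      ∀ (Wd : WeierstrassCurve ℚ) [Wd.IsElliptic] [Wd.IsGloballyMinimal],
        (∃ C : VariableChange ℚ, C • Wd = W.quadraticTwist (NumberField.discr K : ℚ)) →
        MissingUpperBoundAt Wd p := by
  have hCassels := hP.2.1
  have hpar := hP.2.2.2.2.1
  have hnf := hP.2.2.2.2.2.1
  have hHL := hP.2.2.2.2.2.2.1
  have hGZ1 := hP.2.2.2.2.2.2.2.1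
  have hGZ := hP.2.2.2.2.2.2.2.2.1
  have hGZK := hP.2.2.2.2.2.2.2.2.2.2.1
  have hGV := hP.2.2.2.2.2.2.2.2.2.2.2.2.2.1
  have hWu := hP.2.2.2.2.2.2.2.2.2.2.2.2.2.2.1
  have hJn := hP.2.2.2.2.2.2.2.2.2.2.2.2.2.2.2.2.1
  have hHn := hP.2.2.2.2.2.2.2.2.2.2.2.2.2.2.2.2.2.2.1
  have hE : WeierstrassCurve.hasEntireLFunction_rat :=
    WeierstrassCurve.hasEntireLFunction_rat_of_exists_isNewformOf hnf
  have hpP : p.Prime := Fact.out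
  have hp2 : p ≠ 2 := hc.2.1.1
  have hred : ¬ W.HasIrreducibleModPGaloisRep p := hc.2.1.2.1
  have hmult : W.HasMultiplicativeReductionAtPrime p := hc.2.1.2.2
  have hr0 : W.analyticRank = 0 := hc.1
  have hneg : NumberField.discr K < 0 := IsImaginaryQuadratic.discr_neg hK
  have hpd : ¬ (p : ℤ) ∣ NumberField.discr K := not_dvd_discr_of_split hK hpP hp2 hHp
  obtain ⟨C, hC⟩ := hWd
  -- the model `Wd`: X2, GVPar, non-split at `p`, odd analytic rank
  have hXd : ClassX2 Wd p := X2.classX2_twist W p hc.2.1 K hK hHp Wd ⟨C, hC⟩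
  have hgv : GVPar Wd p :=
    gvPar_of_not_gvPar_of_twist (W := W) (p := p) hp2 hred hc.2.2 hneg hpd Wd C (by simpa using hC)
  have hnsd : ¬ Wd.HasSplitMultiplicativeReductionAtPrime p := fun hs ↦
    hns ((X2.hasSplitMultiplicativeReductionAtPrime_iff_of_smul_eq_quadraticTwist W Wd hK p hp2 hmult hHp
      hC).mp hs)
  have hrd : Wd.analyticRank = (W.quadraticTwist (NumberField.discr K : ℚ)).analyticRank := by
    have h := congrArg WeierstrassCurve.analyticRank hC
    rwa [analyticRank_smul] at h
  have hoddd : Odd Wd.analyticRank := by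
    rw [hrd]
    exact EisensteinPrimesMazurMCOnCellBTwistbackLamOneRankOne.odd_analyticRank_quadraticTwist_of_analyticRank_eq_zero
      hnf W hr0 K hK hHN
  -- the reading IS `ord_{T=0} L = 1` on `Wd`
  have hordL : ∀ {M : ℕ} [NeZero M] (f : CuspForm (Gamma0 M) 2), IsNewformOf Wd f →
      ∀ (ϖ : ℚ), (ϖ : ℝ) * Wd.realPeriodRat = plusPeriod f →
      ∀ L : PowerSeries ℚ_[p], IsMultPAdicLFunctionOf f p (-1) L → L.order = ((1 : ℕ) : ℕ∞) := by
    intro M _ f hf ϖ hϖ L hL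
    exact EisensteinPrimesMultOrderOneCoeffCertificate.orderOne_of_coeffOneCertificate hnf Wd p hoddd
      (fun g hg ϖ' hϖ' L' hL' ↦ hC1 g hg ϖ' hϖ' L' hL') f hf ϖ hϖ L hL
  -- `r_an(Wd) = 1` (Perrin-Riou + Disegni), MC at `(Wd, p)` (Greenberg–Vatsal), `BSDp Wd p` (Stein–Wuthrich + Disegni)
  have h1 : Wd.analyticRank = 1 :=
    EisensteinPrimesMultOrderOnePAdicGZ.analyticRank_eq_one_of_orderOne_of_padicGZ hpar hnf hHL hGZ hDGZ Wd p hp2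
      hXd.2.2 hnsd hoddd hordL
  have hcV : X2.CellC Wd p := ⟨h1, hXd⟩
  have hMC : X2.MazurMainConjectureAt Wd p :=
    X2.mazurMainConjectureAt_of_gvPar hGV hWu Wd p hcV.2.1 hcV.2.2.2 hgv
  have hB : BSDp Wd p :=
    X2.bsdp_of_cellC_of_not_split_of_mazurMainConjectureAt_of_orderOne Wd p hDis hJn hHn hGZ1 hGZK hpar hcV hnsd
      hMC hordL
  have hr1 : (W.quadraticTwist (NumberField.discr K : ℚ)).analyticRank = 1 := by rw [← hrd]; exact h1
  -- Cassels transport to every globally minimal model of the twist, then the upper half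
  refine ⟨K, inferInstance, inferInstance, hK, hHN, hHp, hodd, hlt, hr1, fun Wd' _ _ hWd' ↦ ?_⟩
  obtain ⟨C', hC'⟩ := hWd'
  have hrd' : Wd'.analyticRank = 1 := by
    have h := congrArg WeierstrassCurve.analyticRank hC'
    rw [analyticRank_smul] at h
    exact h.trans hr1
  have hiso : IsIsogenous Wd Wd' := (isIsogenous_of_smul_eq hC).trans' (isIsogenous_of_smul_eq' hC')
  have hB' : BSDp Wd' p := X2.bsdp_of_isIsogenous_of_bsdp hCassels hGZK hE Wd Wd' hiso p (le_of_eq h1) hB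
  haveI : Finite Wd'.sha := (hGZK Wd' (le_of_eq hrd')).2
  exact (lower_and_upper_of_missingPPartAt Wd' p (missingPPartAt_of_bsdp Wd' p hB')).2

/-! ## §2. The fold: the REGISTERED stub 6″ from «6‴» (= 6″ off the road-(b) data) + road (b), cone unchanged -/

/-- **The REGISTERED v7 stub 6″ `stub_upperPartnerOffSubrowNoUnitEnd` (statement VERBATIM, conclusion) FROM «6‴» (hypothesis
`hNo3`: 6″ under ONE more negated hypothesis, the road-(b) datum of §1 VERBATIM) + `PublishedInputs` (`hP`) + Disegni 2020
Thm. 4(1) (`hDis`) + Disegni 2020 Thm. 2.4 (`hDGZ`)**: at an X2b pair off the closed sub-row and off the unit ends, excluded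
middle on «`p` non-split ∧ ∃ admissible `K` ∧ ∃ minimal model of the twist with the one-coefficient reading»; ON it §1, OFF
it `hNo3`. No named fact beyond the v7 cone ((2a), (2i′), item -19037). CONDITIONAL; nothing about any curve is proved
unconditionally; the supply of such `K` is OPEN. [cite: Disegni2020, §2.2 Thm. 2.4 and §3.2 Thm. 4]
[cite: SteinWuthrich2013, Thm. 6.1 (p. 20), §4.2] [cite: GreenbergVatsal2000, Thm. (1.3) with pp. 14–15] -/
theorem upperPartnerOffSubrowNoUnitEnd_of_noCoeffOnePartner_of_namedFacts (hP : EisensteinPrimes.PublishedInputs)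
    (hDis : padicBSD_rankOne_nonsplitMult) (hDGZ : padicGrossZagier_nonsplitMult)
    (hNo3 : ∀ (W : WeierstrassCurve ℚ) [W.IsElliptic] [W.IsGloballyMinimal] (p : ℕ) [Fact p.Prime],
      X2.CellB W p →
      ¬ (p = 3 ∧ ¬ W.HasSplitMultiplicativeReductionAtPrime 3 ∧
          ∃ (Φ₀ : AddSubgroup (geomTorsion W (3 : ℤ))) (m : ℕ) (_ : NeZero m) (φ : DirichletCharacter (ZMod 3) m)
            (d : ℕ) (_ : NeZero d) (ψ : DirichletCharacter (ZMod 3) d) (S₀ : Finset (HeightOneSpectrum (𝓞 ℚ))),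
            IsRationalLine W 3 Φ₀ ∧ φ.IsPrimitive ∧ ψ.IsPrimitive ∧
            (∀ (σ : absoluteGaloisGroup ℚ), ∀ P ∈ Φ₀,
              σ • P = (φ ((modNCyclotomicCharacter ℚ m σ : (ZMod m)ˣ) : ZMod m)).val • P) ∧
            (∀ (σ : absoluteGaloisGroup ℚ) (P : geomTorsion W (3 : ℤ)),
              σ • P - (ψ ((modNCyclotomicCharacter ℚ d σ : (ZMod d)ˣ) : ZMod d)).val • P ∈ Φ₀) ∧
            (∀ v ∈ S₀, ((3 : ℕ) : 𝓞 ℚ) ∉ v.asIdeal) ∧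
            (∀ v : HeightOneSpectrum (𝓞 ℚ), v ∉ S₀ → ((3 : ℕ) : 𝓞 ℚ) ∉ v.asIdeal → W.HasGoodReductionAt v) ∧
            1 + ∑ v ∈ S₀, delta W 3 v =
              ∑ v ∈ S₀, ((if φ (Rat.HeightOneSpectrum.natGenerator v : ZMod m) =
                    (Rat.HeightOneSpectrum.natGenerator v : ZMod 3)
                  then sFactor 3 (Rat.HeightOneSpectrum.natGenerator v) else 0) +
                (if ψ (Rat.HeightOneSpectrum.natGenerator v : ZMod d) =
                    (Rat.HeightOneSpectrum.natGenerator v : ZMod 3)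
                  then sFactor 3 (Rat.HeightOneSpectrum.natGenerator v) else 0))) →
      ¬ (∃ (K : Type) (_ : Field K) (_ : NumberField K), IsImaginaryQuadratic K ∧
          SatisfiesHeegnerHypothesis (W.conductorNorm ℤ) K ∧ SatisfiesHeegnerHypothesis p K ∧
          Odd (NumberField.discr K) ∧ NumberField.discr K < -4 ∧
          (W.quadraticTwist (NumberField.discr K : ℚ)).analyticRank = 1 ∧
          ∃ (Wd : WeierstrassCurve ℚ) (_ : Wd.IsElliptic) (_ : Wd.IsGloballyMinimal),
            (∃ C : VariableChange ℚ, C • Wd = W.quadraticTwist (NumberField.discr K : ℚ)) ∧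
            ∃ (K'' : Type) (_ : Field K'') (_ : NumberField K''), IsImaginaryQuadratic K'' ∧
              Odd (NumberField.discr K'') ∧ NumberField.discr K'' < -4 ∧
              SatisfiesHeegnerHypothesis (Wd.conductorNorm ℤ) K'' ∧ SatisfiesHeegnerHypothesis p K'' ∧
              (Wd.quadraticTwist (NumberField.discr K'' : ℚ)).entireLFunction 1 ≠ 0 ∧
              ∃ (W'' : WeierstrassCurve ℚ) (_ : W''.IsElliptic) (_ : W''.IsGloballyMinimal),
                (∃ C : VariableChange ℚ, C • W'' = Wd.quadraticTwist (NumberField.discr K'' : ℚ)) ∧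
                ∃ q : ℚ, shaAn W'' = (q : ℂ) ∧ padicValRat p q = 0) →
      ¬ (¬ W.HasSplitMultiplicativeReductionAtPrime p ∧
          ∃ (K : Type) (_ : Field K) (_ : NumberField K), IsImaginaryQuadratic K ∧
            SatisfiesHeegnerHypothesis (W.conductorNorm ℤ) K ∧ SatisfiesHeegnerHypothesis p K ∧
            Odd (NumberField.discr K) ∧ NumberField.discr K < -4 ∧
            ∃ (Wd : WeierstrassCurve ℚ) (_ : Wd.IsElliptic) (_ : Wd.IsGloballyMinimal),
              (∃ C : VariableChange ℚ, C • Wd = W.quadraticTwist (NumberField.discr K : ℚ)) ∧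
              ∀ {M : ℕ} [NeZero M] (f : CuspForm (Gamma0 M) 2), IsNewformOf Wd f →
                ∀ (ϖ : ℚ), (ϖ : ℝ) * Wd.realPeriodRat = plusPeriod f →
                ∀ L : PowerSeries ℚ_[p], IsMultPAdicLFunctionOf f p (-1) L →
                  ∃ k : ℕ, (p : ℝ) ^ (-((k : ℤ) + 1)) <
                    ‖PowerSeries.coeff 1 (PowerSeries.C ((ϖ : ℚ) : ℚ_[p]) * L)‖) →
      ∃ (K : Type) (_ : Field K) (_ : NumberField K), IsImaginaryQuadratic K ∧
        SatisfiesHeegnerHypothesis (W.conductorNorm ℤ) K ∧ SatisfiesHeegnerHypothesis p K ∧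
        Odd (NumberField.discr K) ∧ NumberField.discr K < -4 ∧
        (W.quadraticTwist (NumberField.discr K : ℚ)).analyticRank = 1 ∧
        ∀ (Wd : WeierstrassCurve ℚ) [Wd.IsElliptic] [Wd.IsGloballyMinimal],
          (∃ C : VariableChange ℚ, C • Wd = W.quadraticTwist (NumberField.discr K : ℚ)) →
          MissingUpperBoundAt Wd p) :
    ∀ (W : WeierstrassCurve ℚ) [W.IsElliptic] [W.IsGloballyMinimal] (p : ℕ) [Fact p.Prime],
      X2.CellB W p →
      ¬ (p = 3 ∧ ¬ W.HasSplitMultiplicativeReductionAtPrime 3 ∧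
          ∃ (Φ₀ : AddSubgroup (geomTorsion W (3 : ℤ))) (m : ℕ) (_ : NeZero m) (φ : DirichletCharacter (ZMod 3) m)
            (d : ℕ) (_ : NeZero d) (ψ : DirichletCharacter (ZMod 3) d) (S₀ : Finset (HeightOneSpectrum (𝓞 ℚ))),
            IsRationalLine W 3 Φ₀ ∧ φ.IsPrimitive ∧ ψ.IsPrimitive ∧
            (∀ (σ : absoluteGaloisGroup ℚ), ∀ P ∈ Φ₀,
              σ • P = (φ ((modNCyclotomicCharacter ℚ m σ : (ZMod m)ˣ) : ZMod m)).val • P) ∧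
            (∀ (σ : absoluteGaloisGroup ℚ) (P : geomTorsion W (3 : ℤ)),
              σ • P - (ψ ((modNCyclotomicCharacter ℚ d σ : (ZMod d)ˣ) : ZMod d)).val • P ∈ Φ₀) ∧
            (∀ v ∈ S₀, ((3 : ℕ) : 𝓞 ℚ) ∉ v.asIdeal) ∧
            (∀ v : HeightOneSpectrum (𝓞 ℚ), v ∉ S₀ → ((3 : ℕ) : 𝓞 ℚ) ∉ v.asIdeal → W.HasGoodReductionAt v) ∧
            1 + ∑ v ∈ S₀, delta W 3 v =
              ∑ v ∈ S₀, ((if φ (Rat.HeightOneSpectrum.natGenerator v : ZMod m) =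
                    (Rat.HeightOneSpectrum.natGenerator v : ZMod 3)
                  then sFactor 3 (Rat.HeightOneSpectrum.natGenerator v) else 0) +
                (if ψ (Rat.HeightOneSpectrum.natGenerator v : ZMod d) =
                    (Rat.HeightOneSpectrum.natGenerator v : ZMod 3)
                  then sFactor 3 (Rat.HeightOneSpectrum.natGenerator v) else 0))) →
      ¬ (∃ (K : Type) (_ : Field K) (_ : NumberField K), IsImaginaryQuadratic K ∧
          SatisfiesHeegnerHypothesis (W.conductorNorm ℤ) K ∧ SatisfiesHeegnerHypothesis p K ∧
          Odd (NumberField.discr K) ∧ NumberField.discr K < -4 ∧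
          (W.quadraticTwist (NumberField.discr K : ℚ)).analyticRank = 1 ∧
          ∃ (Wd : WeierstrassCurve ℚ) (_ : Wd.IsElliptic) (_ : Wd.IsGloballyMinimal),
            (∃ C : VariableChange ℚ, C • Wd = W.quadraticTwist (NumberField.discr K : ℚ)) ∧
            ∃ (K'' : Type) (_ : Field K'') (_ : NumberField K''), IsImaginaryQuadratic K'' ∧
              Odd (NumberField.discr K'') ∧ NumberField.discr K'' < -4 ∧
              SatisfiesHeegnerHypothesis (Wd.conductorNorm ℤ) K'' ∧ SatisfiesHeegnerHypothesis p K'' ∧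
              (Wd.quadraticTwist (NumberField.discr K'' : ℚ)).entireLFunction 1 ≠ 0 ∧
              ∃ (W'' : WeierstrassCurve ℚ) (_ : W''.IsElliptic) (_ : W''.IsGloballyMinimal),
                (∃ C : VariableChange ℚ, C • W'' = Wd.quadraticTwist (NumberField.discr K'' : ℚ)) ∧
                ∃ q : ℚ, shaAn W'' = (q : ℂ) ∧ padicValRat p q = 0) →
      ∃ (K : Type) (_ : Field K) (_ : NumberField K), IsImaginaryQuadratic K ∧
        SatisfiesHeegnerHypothesis (W.conductorNorm ℤ) K ∧ SatisfiesHeegnerHypothesis p K ∧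
        Odd (NumberField.discr K) ∧ NumberField.discr K < -4 ∧
        (W.quadraticTwist (NumberField.discr K : ℚ)).analyticRank = 1 ∧
        ∀ (Wd : WeierstrassCurve ℚ) [Wd.IsElliptic] [Wd.IsGloballyMinimal],
          (∃ C : VariableChange ℚ, C • Wd = W.quadraticTwist (NumberField.discr K : ℚ)) →
          MissingUpperBoundAt Wd p := by
  intro W _ _ p _ hc hsub hue
  by_cases hb : (¬ W.HasSplitMultiplicativeReductionAtPrime p ∧
          ∃ (K : Type) (_ : Field K) (_ : NumberField K), IsImaginaryQuadratic K ∧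
            SatisfiesHeegnerHypothesis (W.conductorNorm ℤ) K ∧ SatisfiesHeegnerHypothesis p K ∧
            Odd (NumberField.discr K) ∧ NumberField.discr K < -4 ∧
            ∃ (Wd : WeierstrassCurve ℚ) (_ : Wd.IsElliptic) (_ : Wd.IsGloballyMinimal),
              (∃ C : VariableChange ℚ, C • Wd = W.quadraticTwist (NumberField.discr K : ℚ)) ∧
              ∀ {M : ℕ} [NeZero M] (f : CuspForm (Gamma0 M) 2), IsNewformOf Wd f →
                ∀ (ϖ : ℚ), (ϖ : ℝ) * Wd.realPeriodRat = plusPeriod f →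
                ∀ L : PowerSeries ℚ_[p], IsMultPAdicLFunctionOf f p (-1) L →
                  ∃ k : ℕ, (p : ℝ) ^ (-((k : ℤ) + 1)) <
                    ‖PowerSeries.coeff 1 (PowerSeries.C ((ϖ : ℚ) : ℚ_[p]) * L)‖)
  · obtain ⟨hns, K, _, _, hK, hHN, hHp, hoddK, hlt, Wd, _, _, hWd, hC1⟩ := hb
    exact upperPartner_at_of_coeffOne_partnerAt_of_padicGZ hP hDis hDGZ W p hc hns K hK hHN hHp hoddK hlt Wd hWd
      (fun g hg ϖ hϖ L hL ↦ hC1 g hg ϖ hϖ L hL)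
  · exact hNo3 W p hc hsub hue hb

/-! ## §3. Crux 3 BY NAME from the v7 cone with 6″ narrowed to 6‴ -/

/-- **CRUX 3 `MazurMCOnCellB` BY NAME from `PublishedInputs` (stmt-…-19037, `hP`) + the EIGHT PUBLISHED named facts of the
v7 cone — (2a) Disegni 2020 Thm. 4(1) (`hDis`), (2c) Mazur 1978 Cor. 4.1 (`hMaz`), (2f) Hsieh 2014 Thm. A (`hH`), (2g)
Liu–Zhang–Zhang 2018 Thms. 1.5.1/1.5.3 (`hF`), (2h) Greenberg–Vatsal 2000 Thm. (3.11) (`h311`), (2i′) Disegni 2020 Thm. 2.4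
(`hDGZ`), (2j) Nakagawa–Horie 1988 + Taya 2000 (`hNHT`), (2k) Wuthrich 2014 Prop. 21 (`hW21`) — + Keller–Yin Thm. D (`hD`,
UNREFEREED PREPRINT) + «6‴» (`hNo3`: the registered 6″ off the road-(b) data)**: §2, then LEAD x2-p1 g13's v7-cone theorem
`…OfNamedFactsV7.mazurMCOnCellB_of_namedFacts_of_upperPartnerOffSubrowNoUnitEnd` (p665922). The cone is that of v7 — the
road-(b) fold costs no named fact. CONDITIONAL on the named facts exactly as labelled and on the OPEN hypothesis `hNo3`; no
summit statement, no Mazur MC, no BSD is proved for any curve by this. [claim: KellerYin2024, status: under-review]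
[cite: KellerYin2024, Thm. D = Thm. 5.1.3 (arXiv:2402.12781v2 L306–L309)] [cite: Disegni2020, §2.2 Thm. 2.4 and §3.2 Thm. 4]
[cite: GreenbergVatsal2000, §3 Thm. (3.11)] [cite: Mazur1978, Cor. 4.1] [cite: LiuZhangZhang2018, Thm. 1.5.1 and Thm. 1.5.3]
[cite: Hsieh2014, Thm. A (p. 712)] [cite: NakagawaHorie1988, Thm. 1] [cite: Wuthrich2014, Prop. 21 (p. 400)] -/
theorem mazurMCOnCellB_of_namedFacts_of_noUnitEnd_noCoeffOnePartner (hP : EisensteinPrimes.PublishedInputs)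
    (hDis : padicBSD_rankOne_nonsplitMult) (hMaz : mazur_not_dvd_maninConstant_of_odd)
    (hH : hsieh2014_exists_anticyclotomicPAdicLFunction) (hF : LiuZhangZhang2018.thm151_thm153_modularCurve_heegnerVector)
    (h311 : thm311_hasUnitContent_iff_and_order_eq_of_lineRamifiedEven) (hDGZ : padicGrossZagier_nonsplitMult)
    (hNHT : Literature.NumberTheory.QuadraticFields.nakagawaHorie_taya_exists_imaginary_h3_eq_one)
    (hW21 : sha_dvd_analyticSha)
    (hD : KellerYin2024.thmD_imcMult_exists_isBDPLFunction_isTorsion_charIdeal_eq_OPEN)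
    (hNo3 : ∀ (W : WeierstrassCurve ℚ) [W.IsElliptic] [W.IsGloballyMinimal] (p : ℕ) [Fact p.Prime],
      X2.CellB W p →
      ¬ (p = 3 ∧ ¬ W.HasSplitMultiplicativeReductionAtPrime 3 ∧
          ∃ (Φ₀ : AddSubgroup (geomTorsion W (3 : ℤ))) (m : ℕ) (_ : NeZero m) (φ : DirichletCharacter (ZMod 3) m)
            (d : ℕ) (_ : NeZero d) (ψ : DirichletCharacter (ZMod 3) d) (S₀ : Finset (HeightOneSpectrum (𝓞 ℚ))),
            IsRationalLine W 3 Φ₀ ∧ φ.IsPrimitive ∧ ψ.IsPrimitive ∧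
            (∀ (σ : absoluteGaloisGroup ℚ), ∀ P ∈ Φ₀,
              σ • P = (φ ((modNCyclotomicCharacter ℚ m σ : (ZMod m)ˣ) : ZMod m)).val • P) ∧
            (∀ (σ : absoluteGaloisGroup ℚ) (P : geomTorsion W (3 : ℤ)),
              σ • P - (ψ ((modNCyclotomicCharacter ℚ d σ : (ZMod d)ˣ) : ZMod d)).val • P ∈ Φ₀) ∧
            (∀ v ∈ S₀, ((3 : ℕ) : 𝓞 ℚ) ∉ v.asIdeal) ∧
            (∀ v : HeightOneSpectrum (𝓞 ℚ), v ∉ S₀ → ((3 : ℕ) : 𝓞 ℚ) ∉ v.asIdeal → W.HasGoodReductionAt v) ∧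
            1 + ∑ v ∈ S₀, delta W 3 v =
              ∑ v ∈ S₀, ((if φ (Rat.HeightOneSpectrum.natGenerator v : ZMod m) =
                    (Rat.HeightOneSpectrum.natGenerator v : ZMod 3)
                  then sFactor 3 (Rat.HeightOneSpectrum.natGenerator v) else 0) +
                (if ψ (Rat.HeightOneSpectrum.natGenerator v : ZMod d) =
                    (Rat.HeightOneSpectrum.natGenerator v : ZMod 3)
                  then sFactor 3 (Rat.HeightOneSpectrum.natGenerator v) else 0))) →
      ¬ (∃ (K : Type) (_ : Field K) (_ : NumberField K), IsImaginaryQuadratic K ∧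
          SatisfiesHeegnerHypothesis (W.conductorNorm ℤ) K ∧ SatisfiesHeegnerHypothesis p K ∧
          Odd (NumberField.discr K) ∧ NumberField.discr K < -4 ∧
          (W.quadraticTwist (NumberField.discr K : ℚ)).analyticRank = 1 ∧
          ∃ (Wd : WeierstrassCurve ℚ) (_ : Wd.IsElliptic) (_ : Wd.IsGloballyMinimal),
            (∃ C : VariableChange ℚ, C • Wd = W.quadraticTwist (NumberField.discr K : ℚ)) ∧
            ∃ (K'' : Type) (_ : Field K'') (_ : NumberField K''), IsImaginaryQuadratic K'' ∧
              Odd (NumberField.discr K'') ∧ NumberField.discr K'' < -4 ∧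
              SatisfiesHeegnerHypothesis (Wd.conductorNorm ℤ) K'' ∧ SatisfiesHeegnerHypothesis p K'' ∧
              (Wd.quadraticTwist (NumberField.discr K'' : ℚ)).entireLFunction 1 ≠ 0 ∧
              ∃ (W'' : WeierstrassCurve ℚ) (_ : W''.IsElliptic) (_ : W''.IsGloballyMinimal),
                (∃ C : VariableChange ℚ, C • W'' = Wd.quadraticTwist (NumberField.discr K'' : ℚ)) ∧
                ∃ q : ℚ, shaAn W'' = (q : ℂ) ∧ padicValRat p q = 0) →
      ¬ (¬ W.HasSplitMultiplicativeReductionAtPrime p ∧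
          ∃ (K : Type) (_ : Field K) (_ : NumberField K), IsImaginaryQuadratic K ∧
            SatisfiesHeegnerHypothesis (W.conductorNorm ℤ) K ∧ SatisfiesHeegnerHypothesis p K ∧
            Odd (NumberField.discr K) ∧ NumberField.discr K < -4 ∧
            ∃ (Wd : WeierstrassCurve ℚ) (_ : Wd.IsElliptic) (_ : Wd.IsGloballyMinimal),
              (∃ C : VariableChange ℚ, C • Wd = W.quadraticTwist (NumberField.discr K : ℚ)) ∧
              ∀ {M : ℕ} [NeZero M] (f : CuspForm (Gamma0 M) 2), IsNewformOf Wd f →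
                ∀ (ϖ : ℚ), (ϖ : ℝ) * Wd.realPeriodRat = plusPeriod f →
                ∀ L : PowerSeries ℚ_[p], IsMultPAdicLFunctionOf f p (-1) L →
                  ∃ k : ℕ, (p : ℝ) ^ (-((k : ℤ) + 1)) <
                    ‖PowerSeries.coeff 1 (PowerSeries.C ((ϖ : ℚ) : ℚ_[p]) * L)‖) →
      ∃ (K : Type) (_ : Field K) (_ : NumberField K), IsImaginaryQuadratic K ∧
        SatisfiesHeegnerHypothesis (W.conductorNorm ℤ) K ∧ SatisfiesHeegnerHypothesis p K ∧
        Odd (NumberField.discr K) ∧ NumberField.discr K < -4 ∧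
        (W.quadraticTwist (NumberField.discr K : ℚ)).analyticRank = 1 ∧
        ∀ (Wd : WeierstrassCurve ℚ) [Wd.IsElliptic] [Wd.IsGloballyMinimal],
          (∃ C : VariableChange ℚ, C • Wd = W.quadraticTwist (NumberField.discr K : ℚ)) →
          MissingUpperBoundAt Wd p) :
    Summit.BirchSwinnertonDyer.BirchSwinnertonDyer.Theses.EisensteinPrimes.MazurMCOnCellB :=
  EisensteinPrimesMazurMCOnCellBOfNamedFactsV7.mazurMCOnCellB_of_namedFacts_of_upperPartnerOffSubrowNoUnitEnd hP hDis
    hMaz hH hF h311 hDGZ hNHT hW21 hD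
    (upperPartnerOffSubrowNoUnitEnd_of_noCoeffOnePartner_of_namedFacts hP hDis hDGZ hNo3)

end Summit.BirchSwinnertonDyer.BirchSwinnertonDyer.Theorems.EisensteinPrimesMazurMCOnCellBTwistbackCoeffOnePartnerAt

end
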